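import Literature.Claims.NS.Kyritsis2017
import Literature.Analysis.FluidPDE.ParticleTrajectoryFlow
import Summits.NavierStokesRegularity.NavierStokesRegularity.Theorems.SoloRefuteKyritsis2021
import HarnessLib

/-!
# Claim C03c `Kyritsis2017` (cell `ns-claims`, D-0090): the ADDED HYPOTHESIS «conservation of
# particles as local structure» (Definition 5.1, print p. 314) is satisfied by every solution that is
# `C¹`-bounded on the time slab — refuter-side kernel record for the verdict «wrong problem»

Claim skeleton: `Literature/Claims/NS/Kyritsis2017.lean` (typist `ns-claims-typist-3`, p463635).
Refuter `ns-claims-refuter-7`; referee `ns-claims-ref-2`; filed under interim convention (b) by the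
salvage seat.

PROPOSITION 5.2 (p. 315) concludes regularity for the Euler and Navier–Stokes equations under the
ADDED hypothesis `ConservationOfParticles u T` (Definition 5.1, p. 314) on the SOLUTION. The typed
conditional statement is TRUE (typist's `step4_of_step1`, referee's `step5_holds` /
`claimedTheorem_holds`: Definition 5.1 (2)+(3) bound `u` and `∇u` in sup-norm uniformly on
`[0,T)`, and Beale–Kato–Majda continues the solution). This file records the CONVERSE side, which
is what makes the verdict «wrong problem (Δ6: conditional criterion)» sharp:

* `conservationOfParticles_of_bounded` — for ANY classical solution on `[0,T)` (any `ν`), uniform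
  bounds on `u`, `∇u` and `∇∂ₜu` on `[0,T) × ℝ³` imply Definition 5.1 on `[0,T)`, with the
  trajectory map `X(s,t,·) = φ(t,s,·)` = the tree's evolution map of `u` (Majda–Bertozzi §1.3
  (1.13), `Literature.Analysis.FluidPDE.ParticleTrajectoryFlow`), radius `r = 1`, the whole space as
  cover, and constants `δx = 2 C₀ T + 1`, `δu = 2 C₀ + 1`, `δω = 2 max(C₁,C₂) + 1`. So the added
  hypothesis EXCLUDES NOTHING but solutions whose `C¹` norm is unbounded before `T` — by
  Prop. 4.8 / BKM (`step2_holds`) exactly the solutions that fail to continue: the hypothesis of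
  Prop. 5.2 has the strength of its conclusion, and carries no information toward Clay (A).
* `conservationOfParticles_steady` — in particular every smooth compactly supported STEADY flow
  satisfies Definition 5.1 on every `[0,T)`; with Gavrilov's compactly supported steady Euler flow
  (`gavrilov_compact_steady_euler_holds`) this gives `exists_inhabitant_euler`: the hypotheses
  «class solution on `[0,T)` (ν = 0) ∧ compactly supported datum ∧ Definition 5.1 on `[0,T)`» of
  `ClaimedTheorem` are JOINTLY inhabited by a non-zero flow for every `T > 0` (non-vacuity; the
  print's «connected support» is not asserted for Gavrilov's flow and is not used by any step).

WHAT THIS IS NOT: not a statement about the Navier–Stokes problem itself; not about any author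
beyond the typed locator. [cite: Kyritsis2017, Definition 5.1 p. 314; Proposition 5.2 p. 315]
-/

noncomputable section

open Set Metric Function
open Literature.Analysis.FluidPDE Literature.Claims.NS.Kyritsis2017
open Literature.Claims.NS.Kyritsis2021 (IsLocalClassSolution)
open scoped ContDiff

-- `Summit.NavierStokesRegularity.NavierStokesRegularity.…` repeats a namespace component by design (D-0017 layout).
set_option linter.dupNamespace false

namespace Summit.NavierStokesRegularity.NavierStokesRegularity.Theorems.Kyritsis2017

variable {ν T : ℝ} {u : ℝ → EuclideanSpace ℝ (Fin 3) → EuclideanSpace ℝ (Fin 3)}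
  {p : ℝ → EuclideanSpace ℝ (Fin 3) → ℝ}

/-- The evolution map of a classical solution with bounded velocity gradient on `[0,T)` is a
trajectory map in the sense of Definition 5.1 (`X s s = id`, `∂ₜ X(s,t,x) = u(t, X(s,t,x))` within
`[s,T)`). [cite: Kyritsis2017, Definition 5.1, p. 314] -/
theorem isTrajectoryMap_evolutionMap (hsol : IsClassicalNSSolutionOn (Ico 0 T) ν 0 u p) {C₁ : ℝ}
    (h₁ : ∀ t ∈ Ico 0 T, ∀ x, ‖fderiv ℝ (u t) x‖ ≤ C₁) :
    IsTrajectoryMap u T (fun s t x => Literature.Analysis.ODE.evolutionMap u s t x) := by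
  have hL : Literature.Analysis.ODE.IsUniformlyLipschitzOn u (Ico 0 T) :=
    hsol.smooth_velocity.isUniformlyLipschitzOn_of_norm_fderiv_le' h₁
  refine ⟨fun s _ x => Literature.Analysis.ODE.evolutionMap_self u s x, fun s hs x t ht => ?_⟩
  exact (hL.hasDerivWithinAt_evolutionMap (convex_Ico 0 T) hs ⟨hs.1.trans ht.1, ht.2⟩ x).mono
    (Ico_subset_Ico_left hs.1)

/-- Displacement bound along a trajectory: `‖X(s,t,x) − x‖ ≤ C₀ (t − s)` when `‖u‖ ≤ C₀` on the
slab. [cite: Kyritsis2017, Definition 5.1 (1), p. 314] -/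
theorem norm_traj_sub_le {X : ℝ → ℝ → EuclideanSpace ℝ (Fin 3) → EuclideanSpace ℝ (Fin 3)}
    (hX : IsTrajectoryMap u T X) {C₀ : ℝ} (h₀ : ∀ t ∈ Ico 0 T, ∀ x, ‖u t x‖ ≤ C₀)
    {s : ℝ} (hs : s ∈ Ico 0 T) {t : ℝ} (ht : t ∈ Ico s T) (x : EuclideanSpace ℝ (Fin 3)) :
    ‖X s t x - x‖ ≤ C₀ * (t - s) := by
  have hderiv : ∀ τ ∈ Icc s t, HasDerivWithinAt (fun τ => X s τ x) (u τ (X s τ x)) (Icc s t) τ :=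
    fun τ hτ => (hX.hasDeriv s hs x τ ⟨hτ.1, hτ.2.trans_lt ht.2⟩).mono
      (Icc_subset_Ico_right ht.2)
  have hbound : ∀ τ ∈ Ico s t, ‖u τ (X s τ x)‖ ≤ C₀ :=
    fun τ hτ => h₀ τ ⟨hs.1.trans hτ.1, hτ.2.trans ht.2⟩ _
  have h := norm_image_sub_le_of_norm_deriv_le_segment' hderiv hbound t
    ⟨ht.1, le_rfl⟩
  simpa [hX.init s hs x] using h

/-- **Definition 5.1 follows from `C¹` space–time bounds.** For a classical solution on `[0,T)`
(any `ν`), uniform bounds on `u`, `∇u`, `∇∂ₜu` over `[0,T) × ℝ³` give «conservation of particles in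
`[0,T)` as local structure» with explicit constants. [cite: Kyritsis2017, Definition 5.1, p. 314] -/
theorem conservationOfParticles_of_bounded (hsol : IsClassicalNSSolutionOn (Ico 0 T) ν 0 u p)
    {C₀ C₁ C₂ : ℝ} (h₀ : ∀ t ∈ Ico 0 T, ∀ x, ‖u t x‖ ≤ C₀)
    (h₁ : ∀ t ∈ Ico 0 T, ∀ x, ‖fderiv ℝ (u t) x‖ ≤ C₁)
    (h₂ : ∀ t ∈ Ico 0 T, ∀ x, ‖fderiv ℝ (timeDerivWithin (Ico 0 T) u t) x‖ ≤ C₂) :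
    ConservationOfParticles u T := by
  set X : ℝ → ℝ → EuclideanSpace ℝ (Fin 3) → EuclideanSpace ℝ (Fin 3) :=
    fun s t x => Literature.Analysis.ODE.evolutionMap u s t x with hXdef
  have hX : IsTrajectoryMap u T X := isTrajectoryMap_evolutionMap hsol h₁
  set A : ℝ := max C₀ 0 with hA
  set B : ℝ := max (max C₁ C₂) 0 with hB
  have hA0 : 0 ≤ A := le_max_right _ _
  have hB0 : 0 ≤ B := le_max_right _ _
  have hT0 : 0 ≤ max T 0 := le_max_right _ _
  have h₀' : ∀ t ∈ Ico 0 T, ∀ x, ‖u t x‖ ≤ A := fun t ht x => (h₀ t ht x).trans (le_max_left _ _)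
  refine ⟨X, hX, 1, one_pos, 2 * A * max T 0 + 1, by positivity, 2 * A + 1, by positivity,
    2 * B + 1, by positivity, fun s hs => ⟨univ, fun x => ⟨x, mem_univ _, mem_ball_self one_pos⟩,
    fun c _ x₁ hx₁ x₂ hx₂ t ht => ?_⟩⟩
  have ht0 : t ∈ Ico 0 T := ⟨hs.1.trans ht.1, ht.2⟩
  have hts : t - s ≤ max T 0 := by
    have : t - s ≤ t := by linarith [hs.1]
    exact this.trans (ht.2.le.trans (le_max_left _ _))
  have hd₁ : ‖X s t x₁ - x₁‖ ≤ A * max T 0 :=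
    (norm_traj_sub_le hX h₀' hs ht x₁).trans (mul_le_mul_of_nonneg_left hts hA0)
  have hd₂ : ‖X s t x₂ - x₂‖ ≤ A * max T 0 :=
    (norm_traj_sub_le hX h₀' hs ht x₂).trans (mul_le_mul_of_nonneg_left hts hA0)
  have h12 : ‖x₁ - x₂‖ ≤ 2 := by
    have h1 : dist x₁ c < 1 := mem_ball.mp hx₁
    have h2 : dist x₂ c < 1 := mem_ball.mp hx₂
    rw [← dist_eq_norm]
    linarith [dist_triangle_right x₁ x₂ c]
  refine ⟨?_, ?_, ?_, ?_⟩
  · -- (1) particle ranges stay of diameter ≤ r + δx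
    calc ‖X s t x₁ - X s t x₂‖
        = ‖(X s t x₁ - x₁) + (x₁ - x₂) - (X s t x₂ - x₂)‖ := by congr 1; abel
      _ ≤ ‖(X s t x₁ - x₁) + (x₁ - x₂)‖ + ‖X s t x₂ - x₂‖ := norm_sub_le _ _
      _ ≤ ‖X s t x₁ - x₁‖ + ‖x₁ - x₂‖ + ‖X s t x₂ - x₂‖ := by
          linarith [norm_add_le (X s t x₁ - x₁) (x₁ - x₂)]
      _ ≤ 1 + (2 * A * max T 0 + 1) := by linarith
  · -- (2) velocity oscillation ≤ δu
    calc ‖u t (X s t x₁) - u t (X s t x₂)‖ ≤ ‖u t (X s t x₁)‖ + ‖u t (X s t x₂)‖ := norm_sub_le _ _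
      _ ≤ A + A := add_le_add (h₀' t ht0 _) (h₀' t ht0 _)
      _ ≤ 2 * A + 1 := by linarith
  · -- (3) spatial-derivative oscillation ≤ δω
    have hb : ∀ y, ‖fderiv ℝ (u t) y‖ ≤ B := fun y =>
      (h₁ t ht0 y).trans ((le_max_left _ _).trans (le_max_left _ _))
    calc ‖fderiv ℝ (u t) (X s t x₁) - fderiv ℝ (u t) (X s t x₂)‖
        ≤ ‖fderiv ℝ (u t) (X s t x₁)‖ + ‖fderiv ℝ (u t) (X s t x₂)‖ := norm_sub_le _ _
      _ ≤ B + B := add_le_add (hb _) (hb _)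
      _ ≤ 2 * B + 1 := by linarith
  · -- (3) for the space–time derivative `∇∂ₜu`
    have hb : ∀ y, ‖fderiv ℝ (timeDerivWithin (Ico 0 T) u t) y‖ ≤ B := fun y =>
      (h₂ t ht0 y).trans ((le_max_right _ _).trans (le_max_left _ _))
    calc ‖fderiv ℝ (timeDerivWithin (Ico 0 T) u t) (X s t x₁) -
          fderiv ℝ (timeDerivWithin (Ico 0 T) u t) (X s t x₂)‖
        ≤ ‖fderiv ℝ (timeDerivWithin (Ico 0 T) u t) (X s t x₁)‖ +
          ‖fderiv ℝ (timeDerivWithin (Ico 0 T) u t) (X s t x₂)‖ := norm_sub_le _ _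
      _ ≤ B + B := add_le_add (hb _) (hb _)
      _ ≤ 2 * B + 1 := by linarith

/-- **Every smooth compactly supported steady flow satisfies Definition 5.1** on every `[0,T)`,
whenever it is (the velocity of) a classical solution there. [cite: Kyritsis2017, Definition 5.1, p. 314] -/
theorem conservationOfParticles_steady {U : EuclideanSpace ℝ (Fin 3) → EuclideanSpace ℝ (Fin 3)}
    {P : EuclideanSpace ℝ (Fin 3) → ℝ}
    (hsol : IsClassicalNSSolutionOn (Ico 0 T) ν 0 (fun _ => U) (fun _ => P))
    (hU : ContDiff ℝ ∞ U) (hUc : HasCompactSupport U) :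
    ConservationOfParticles (fun _ => U) T := by
  obtain ⟨C₀, hC₀⟩ := hU.continuous.bounded_above_of_compact_support hUc
  obtain ⟨C₁, hC₁⟩ := (hU.continuous_fderiv (by simp)).bounded_above_of_compact_support
    (hUc.fderiv (𝕜 := ℝ))
  refine conservationOfParticles_of_bounded hsol (C₀ := C₀) (C₁ := C₁) (C₂ := 0)
    (fun t _ x => hC₀ x) (fun t _ x => hC₁ x) (fun t _ x => ?_)
  have h0 : timeDerivWithin (Ico 0 T) (fun _ : ℝ => U) t = fun _ => 0 := by
    funext y; simp [timeDerivWithin_apply]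
  rw [h0]
  simp

/-- **Non-vacuity of the hypotheses of Prop. 5.2 (Euler case):** Gavrilov's compactly supported
steady Euler flow is, for every `T > 0`, a non-zero class solution on `[0,T)` at `ν = 0` with
compactly supported datum that satisfies Definition 5.1 on `[0,T)`.
[cite: Kyritsis2017, Definition 5.1 p. 314 and Proposition 5.2 p. 315] -/
theorem exists_inhabitant_euler :
    ∃ (U : EuclideanSpace ℝ (Fin 3) → EuclideanSpace ℝ (Fin 3)) (P : EuclideanSpace ℝ (Fin 3) → ℝ),
      U ≠ 0 ∧ HasCompactSupport U ∧ ∀ T : ℝ, 0 < T →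
        IsLocalClassSolution 0 T (fun _ => U) (fun _ => P) ∧
          ConservationOfParticles (fun _ => U) T := by
  obtain ⟨U, P, hU, hP, hUc, -, hU0, hdiv, hE, -⟩ :=
    gavrilov_compact_steady_euler_holds.exists_orthogonal
  refine ⟨U, P, hU0, hUc, fun T _ => ?_⟩
  have hsol := Kyritsis2021.isLocalClassSolution_steady hU hP hUc hdiv hE T
  exact ⟨hsol, conservationOfParticles_steady hsol.1 hU hUc⟩

end Summit.NavierStokesRegularity.NavierStokesRegularity.Theorems.Kyritsis2017

end
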